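import Summits.QuantumFields.YangMills.Theorems.BalabanUVNodesN15KingModelAnalyticTilt
import Summits.QuantumFields.YangMills.Theorems.BalabanUVNodesN15KingModelAnalyticFormBound
import Summits.QuantumFields.YangMills.Theorems.BalabanUVNodesN15KingModelAnalyticBlockPerturbation
import Summits.QuantumFields.YangMills.Theorems.BalabanUVNodesN15KingModelCombesThomasPropagator
import HarnessLib

/-!
# BalabanUVNodes ∕ N15 — THE KING-MODEL RUNG (PART Ϩ-e): THE MASTER COERCIVITY ESTIMATE — the full one-level operator `A(U,V)` at a two-sided COMPLEX link field near a unitary `U₀`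
# with `κ`-coercive `A₀(U₀)` stays Re-coercive, TOGETHER WITH ITS WEIGHT CONJUGATES: `(κ∕2 − ρ_φ − c(d+1)(ε₂^φ + 2(ε₁^φ)²) − e^{ϑ}a((1+ε₁)^{2D} − 1))·Σ‖ω_x‖² ≤ Re⟨ω, A(U,V)_φω⟩`;
# hence invertibility, `‖G(U,V)‖`, and EXPONENTIAL DECAY of `G(U,V) = A(U,V)⁻¹` in the complex window — one estimate, two conclusions (PART Ϩ-b: decay = coercivity at tilted parameters)
# (Track A, DAG node N15 = NE2; FAN-OUT v1.1 §N15 s3 «KING-MODEL RUNG … + what the curved case adds»; count-neutral)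

HONEST FRAMING.  Count-neutral (cell `pub-ymgap`, seat `pub-ymgap-dag-n15-e` g51; `--supports stmt-QuantumFields-27247 --as helper` = K3ᴬ, KEY MAP v3).  King's one-level comparison
model, any tree contour system of depth `≤ D`, any fibre; `a, c, m² ≥ 0`; the source of `κ` is an input (PART Ϥ-o small curvature ∕ Ϥ-g pure gauges ∕ Ϥ-e every `U`).  The assembly:
Ϧ-b (defect of `A₀(U₀)_φ`) + Ϩ-b (the conjugation tilts the perturbation) + Ϩ-c (`H¹` bound of the tilted hopping perturbation, half a gradient absorbed) + Ϩ-d (block term) + Ϧ-a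
(abstract Combes–Thomas).  NOT Bałaban's multi-level `G_k(U)` nor (3.47)–(3.55); NOT a node discharge (N15 of record untouched); nothing continuum ∕ ℝ⁴ ∕ OS ∕ Clay.

THE RESULTS.  Data: `U₀` unitary with `κΣ‖v_x‖² ≤ Re⟨v,A₀(U₀)v⟩`; two-sided `(U,V)` with `‖U_b − U₀_b‖ ≤ ε₁`, `‖V_b − U₀_bᴴ‖ ≤ ε₁`, ZEROTH-ORDER DEFECT `‖(U_b−U₀_b)U₀_bᴴ + U₀_b(V_b−U₀_bᴴ)‖ ≤ ε₂`;
weight `φ` with bond oscillation `≤ δ` and block oscillation `≤ ϑ`; `ρ_φ = 2(d+1)c(cosh δ−1) + a(cosh ϑ−1)` (Ϧ-b), `ε₁^φ = e^{δ}ε₁`, `ε₂^φ = e^{δ}ε₂ + 2(e^{δ}−1)ε₁` (Ϩ-b), `τ = (1+ε₁)^{2D} − 1` (Ϩ-d).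
* §1 `re_star_dotProduct_mulVec_ge_neg_opNorm` (`−‖X‖N(ω) ≤ Re⟨ω,Xω⟩`), `re_quadForm_fullOpU_ge_dirichlet` (`cE_{U₀}(ω) ≤ Re⟨ω,A₀(U₀)ω⟩`, `a, m² ≥ 0`), `cxFullOp_sub_base`
  (`A(U,V) − A₀(U₀) = −T_{δU,δV} + aL^{d+1}(Q♯(V)Q(U) − Q♯(U₀ᴴ)Q(U₀))`), `wtConj_cxFullOp_sub_base` (its conjugate: `−T_{δU^φ,δV^φ} + (…)_φ`).
* §2 ★★★★ **`re_conjForm_cxFullOp_ge`** — THE MASTER ESTIMATE above; ★★★ **`re_quadForm_cxFullOp_ge`** (`φ ≡ 0`: `(κ∕2 − c(d+1)(ε₂ + 2ε₁²) − aτ)N(ω) ≤ Re⟨ω, A(U,V)ω⟩`).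
* §3 CONSEQUENCES at budget `γ > 0`: ★★★ **`isUnit_cxFullOp_of_near`**, ★★★ **`l2_opNorm_cxFullOp_inv_le_of_near`** (`‖G(U,V)‖ ≤ γ⁻¹`), ★★★★ **`norm_blk_cxFullOp_inv_le_of_near`**
  (`‖blk G(U,V) x y‖ ≤ γ_w⁻¹·e^{−(κ_w∕L)d(x,y)}` with the tree weight `ctW`, `γ_w = κ∕2 − ρ(κ_w) − c(d+1)(ε₂^φ + 2(ε₁^φ)²) − e^{κ_w}aτ`), ★★★ `norm_star_dotProduct_cxFullOp_inv_mulVec_le_of_near`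
  (Dimock's bilinear Lemma-30 currency).
* §4 KING's SCALING `c = L²`, `L ≥ 1`, rate `κ_w = ctRate(κ∕2, a, d)` (so `ρ ≤ κ∕4`, Ϧ-c), Bałaban variables `s = Lε₁`, `t = L²ε₂`: `king_tilt_bookkeeping` (`L²(ε₂^φ + 2(ε₁^φ)²) ≤ e(t + 2s) + 2e²s²`),
  ★★★★ **`norm_blk_cxFullOp_inv_le_king_of_near`** (`(d+1)(e(t + 2s) + 2e²s²) + e·a·τ ≤ κ∕8` ⟹ `‖blk G(U,V) x y‖ ≤ (8∕κ)·e^{−ctRate(κ∕2,a,d)·d(x,y)∕L}`),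
  ★★★ **`l2_opNorm_cxFullOp_inv_le_king_of_near`** (`(d+1)(t + 2s²) + aτ ≤ κ∕4` ⟹ `‖G(U,V)‖ ≤ 4∕κ`), ★★★ `isUnit_cxFullOp_king_of_near`.  The window is in `(s,t) = (Lε₁, L²ε₂)`:
  BAŁABAN's SCALE when `ε₂ = O(ε₁²)` (print's slice, PART Ϩ-f), `O(η²)` when `ε₂ ≍ ε₁` (two-sided, PART Ϛ-d sharp).
PRIOR TREE ART (by name): Ϩ-a (`cxFullOp`, `cxFullOp_adjoint`, `cxFullOp_sub_cxFullOp`), Ϩ-b (`tiltFwd∕Bwd`, `wtConj_cxHop`, `tiltFwd_sub`, `norm_tiltFwd_le`, `norm_tilt_zeroth_le`), Ϩ-c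
(`norm_quadForm_cxHop_le_absorbed`), Ϩ-d (`l2_opNorm_wtConj_cxBlockTerm_sub_le`), Ϧ-a (`wtConj_*`, `isUnit_of_reCoercive`, `l2_opNorm_inv_le_of_reCoercive`, `norm_blk_inv_le_of_conjCoercive`,
`l2_opNorm_wtConj_inv_le`, `norm_star_dotProduct_inv_mulVec_le`), Ϧ-b (`re_conjForm_fullOpU_sub_ge`), Ϧ-c (`ctRate`, `ctRate_nonneg∕_le_one`, `half_le_sub_rho_ctRate`, `ctW_sub_ctW_centre`), Ϥ-d
(`fullOpU`, `re_quadForm_fullOpU`), Ϛ-a (`cxHop_sub`), Ϛ-n (`norm_star_dotProduct_le`), `King1986.Torus` (`ctW`, `abs_ctW_bond_le`, `abs_ctW_block_le`, `tdistT`), Mathlib.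
Dedup (rg at filing): basename 0 files; needles `re_conjForm_cxFullOp_ge|isUnit_cxFullOp_of_near|norm_blk_cxFullOp_inv_le` 0 tree files.  presearch: n/a (assembly of this PART's lemmas).
Locators: [Balaban1985BackgroundPropagators] Thm 3.1 p.397, §3.B p.399 l.37–40, Thm 3.4 p.400, (3.48)–(3.53) pp.398–400; [Dimock2013] App. D Lemmas 29–30; [King1986] (2.13) p.653, (4.33)–(4.34) p.674.  0 `sorry`, 0 `def`.
-/

noncomputable section
open scoped BigOperators ComplexConjugate ComplexOrder InnerProductSpace Matrix.Norms.L2Operator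
open Finset Matrix WithLp

namespace Summit.QuantumFields.YangMills.BalabanUVNodes.N15KingModelRung.Analytic

open Literature.MathematicalPhysics.QuantumFieldTheory.LatticeDiamagneticInequality (blk)
open Literature.MathematicalPhysics.QuantumFieldTheory.Balaban1983to89.B5Prop11Plancherel (Tor fine unitVec)
open Literature.MathematicalPhysics.QuantumFieldTheory.King1986.Torus (blockOf ctW abs_ctW_bond_le abs_ctW_block_le tdistT)
open Summit.QuantumFields.YangMills.BalabanUVNodes.N15KingModelRung.Covariant (cxHop cxLapF cxHop_sub cxHop_smul fib sum_norm_fib_sq norm_star_dotProduct_le)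
open Summit.QuantumFields.YangMills.BalabanUVNodes.N15KingModelRung.Curvature (bondE expWt)
open Summit.QuantumFields.YangMills.BalabanUVNodes.N15KingModelRung.CovariantBlock (BlockTree covQ fullOpU re_quadForm_fullOpU)
open Summit.QuantumFields.YangMills.BalabanUVNodes.N15KingModelRung.CombesThomas
  (wtConj wtConj_add wtConj_sub wtConj_smul star_dotProduct_wtConj_mulVec isUnit_of_reCoercive l2_opNorm_inv_le_of_reCoercive norm_blk_inv_le_of_conjCoercive l2_opNorm_wtConj_inv_le
    norm_star_dotProduct_inv_mulVec_le re_conjForm_fullOpU_sub_ge ctRate ctRate_nonneg ctRate_le_one ctRate_pos half_le_sub_rho_ctRate ctW_sub_ctW_centre)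

variable {d : ℕ} {L : ℕ} [NeZero L] (T : BlockTree d L) (M : Fin (d + 1) → ℕ) [hM : ∀ μ, NeZero (M μ)]
variable {𝕜 : Type*} [RCLike 𝕜] {n : Type*} [Fintype n] [DecidableEq n]

/-! ## §1 Tools -/

section Tools

/-- `−‖X‖·Σ‖ω_x‖² ≤ Re⟨ω, Xω⟩` (Cauchy–Schwarz and the operator norm). [folklore] -/
theorem re_star_dotProduct_mulVec_ge_neg_opNorm (X : Matrix (Tor (fine L M) × n) (Tor (fine L M) × n) 𝕜) (ω : Tor (fine L M) × n → 𝕜) :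
    -(‖X‖ * ∑ x, ‖fib (fine L M) ω x‖ ^ 2) ≤ RCLike.re (star ω ⬝ᵥ (X *ᵥ ω)) := by
  have h1 : ‖star ω ⬝ᵥ (X *ᵥ ω)‖ ≤ ‖X‖ * ∑ x, ‖fib (fine L M) ω x‖ ^ 2 := by
    rw [sum_norm_fib_sq]
    calc ‖star ω ⬝ᵥ (X *ᵥ ω)‖ ≤ ‖(toLp 2 ω : EuclideanSpace 𝕜 (Tor (fine L M) × n))‖ * ‖(toLp 2 (X *ᵥ ω) : EuclideanSpace 𝕜 (Tor (fine L M) × n))‖ := norm_star_dotProduct_le _ ω _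
      _ ≤ ‖(toLp 2 ω : EuclideanSpace 𝕜 (Tor (fine L M) × n))‖ * (‖X‖ * ‖(toLp 2 ω : EuclideanSpace 𝕜 (Tor (fine L M) × n))‖) :=
          mul_le_mul_of_nonneg_left (Matrix.l2_opNorm_mulVec X _) (norm_nonneg _)
      _ = ‖X‖ * ‖(toLp 2 ω : EuclideanSpace 𝕜 (Tor (fine L M) × n))‖ ^ 2 := by ring
  have h2 : |RCLike.re (star ω ⬝ᵥ (X *ᵥ ω))| ≤ ‖star ω ⬝ᵥ (X *ᵥ ω)‖ := RCLike.abs_re_le_norm _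
  have h3 := neg_le_of_abs_le (h2.trans h1)
  linarith

/-- `cE_{U₀}(ω) ≤ Re⟨ω, A₀(U₀)ω⟩` for unitary `U₀`, `a, m² ≥ 0` (Ϥ-d `re_quadForm_fullOpU`). [cite: King1986, (2.13) p.653; Balaban1985BackgroundPropagators, (3.24) p.394] -/
theorem re_quadForm_fullOpU_ge_dirichlet {a c m2 : ℝ} (ha : 0 ≤ a) (hm : 0 ≤ m2) {U₀ : Tor (fine L M) × Fin (d + 1) → Matrix n n 𝕜} (hU₀ : ∀ bd, U₀ bd ∈ Matrix.unitaryGroup n 𝕜)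
    (ω : Tor (fine L M) × n → 𝕜) : c * ∑ x, ∑ μ, bondE (fine L M) U₀ ω x μ ≤ RCLike.re (star ω ⬝ᵥ (fullOpU T M a c m2 U₀ *ᵥ ω)) := by
  rw [re_quadForm_fullOpU T M a c m2 hU₀ ω]
  have h1 : 0 ≤ m2 * ∑ x, ‖fib (fine L M) ω x‖ ^ 2 := mul_nonneg hm (Finset.sum_nonneg fun _ _ => sq_nonneg _)
  have hL : (0 : ℝ) ≤ (L : ℝ) ^ (d + 1) := by positivity
  have h2 : 0 ≤ a * (L : ℝ) ^ (d + 1) * ∑ y, ‖fib M (covQ T M U₀ *ᵥ ω) y‖ ^ 2 := mul_nonneg (mul_nonneg ha hL) (Finset.sum_nonneg fun _ _ => sq_nonneg _)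
  linarith

/-- THE PERTURBATION AROUND THE BASE: `A(U,V) − A(U₀,U₀ᴴ) = −T_{U−U₀, V−U₀ᴴ} + aL^{d+1}(Q♯(V)Q(U) − Q♯(U₀ᴴ)Q(U₀))`. [cite: Balaban1985BackgroundPropagators, (3.48)–(3.50) pp.398–400] -/
theorem cxFullOp_sub_base (a c m2 : ℝ) (U₀ U V : Tor (fine L M) × Fin (d + 1) → Matrix n n 𝕜) :
    cxFullOp T M a c m2 U V - cxFullOp T M a c m2 U₀ (fun bd => (U₀ bd)ᴴ)
      = -cxHop (fine L M) c (U - U₀) (V - fun bd => (U₀ bd)ᴴ) + ((a * (L : ℝ) ^ (d + 1) : ℝ) : 𝕜) • (cxQadj T M V * covQ T M U - cxQadj T M (fun bd => (U₀ bd)ᴴ) * covQ T M U₀) := by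
  have hneg : cxHop (fine L M) c (U₀ - U) ((fun bd => (U₀ bd)ᴴ) - V) = -cxHop (fine L M) c (U - U₀) (V - fun bd => (U₀ bd)ᴴ) := by
    rw [← neg_sub U U₀, ← neg_sub V (fun bd => (U₀ bd)ᴴ), ← neg_one_smul 𝕜 (U - U₀), ← neg_one_smul 𝕜 (V - fun bd => (U₀ bd)ᴴ), cxHop_smul, neg_one_smul]
  rw [cxFullOp_sub_cxFullOp, ← cxHop_sub, hneg]

/-- ITS WEIGHT CONJUGATE: `(A(U,V) − A₀(U₀))_φ = −T_{(U−U₀)^φ,(V−U₀ᴴ)^φ} + (aL^{d+1}(Q♯(V)Q(U) − Q♯(U₀ᴴ)Q(U₀)))_φ` (Ϩ-b `wtConj_cxHop`). [cite: Balaban1985BackgroundPropagators, §3.B p.399 l.37–40] -/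
theorem wtConj_cxFullOp_sub_base (φ : Tor (fine L M) → ℝ) (a c m2 : ℝ) (U₀ U V : Tor (fine L M) × Fin (d + 1) → Matrix n n 𝕜) :
    wtConj (fine L M) φ (cxFullOp T M a c m2 U V - cxFullOp T M a c m2 U₀ (fun bd => (U₀ bd)ᴴ))
      = -cxHop (fine L M) c (tiltFwd (fine L M) φ (U - U₀)) (tiltBwd (fine L M) φ (V - fun bd => (U₀ bd)ᴴ))
        + wtConj (fine L M) φ (((a * (L : ℝ) ^ (d + 1) : ℝ) : 𝕜) • (cxQadj T M V * covQ T M U - cxQadj T M (fun bd => (U₀ bd)ᴴ) * covQ T M U₀)) := by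
  rw [cxFullOp_sub_base, wtConj_add, ← wtConj_cxHop]
  congr 1
  ext p q; simp only [CombesThomas.wtConj_apply, Matrix.neg_apply, mul_neg]

end Tools

/-! ## §2 The master estimate -/

section Master

variable {D : ℕ} (hD : ∀ j, T.depth j ≤ D)
variable {a c m2 : ℝ} (ha : 0 ≤ a) (hc : 0 ≤ c) (hm : 0 ≤ m2)
variable {U₀ : Tor (fine L M) × Fin (d + 1) → Matrix n n 𝕜} (hU₀ : ∀ bd, U₀ bd ∈ Matrix.unitaryGroup n 𝕜)
variable {κ : ℝ} (hcoer : ∀ v : Tor (fine L M) × n → 𝕜, κ * ∑ x, ‖fib (fine L M) v x‖ ^ 2 ≤ RCLike.re (star v ⬝ᵥ (fullOpU T M a c m2 U₀ *ᵥ v)))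
variable {U V : Tor (fine L M) × Fin (d + 1) → Matrix n n 𝕜} {ε₁ ε₂ : ℝ} (hε₁ : 0 ≤ ε₁)
  (hU : ∀ bd, ‖U bd - U₀ bd‖ ≤ ε₁) (hV : ∀ bd, ‖V bd - (U₀ bd)ᴴ‖ ≤ ε₁) (h0 : ∀ bd, ‖(U bd - U₀ bd) * (U₀ bd)ᴴ + U₀ bd * (V bd - (U₀ bd)ᴴ)‖ ≤ ε₂)
include hD ha hc hm hU₀ hcoer hε₁ hU hV h0

/-- ★★★★ **THE MASTER COERCIVITY ESTIMATE**: for every weight `φ` with `|φ(x) − φ(x+e_μ)| ≤ δ` on bonds and `|φ(x) − φ(x′)| ≤ ϑ` on blocks,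
`(κ∕2 − (2(d+1)c(cosh δ−1) + a(cosh ϑ−1)) − c(d+1)((e^{δ}ε₂ + 2(e^{δ}−1)ε₁) + 2(e^{δ}ε₁)²) − e^{ϑ}a((1+ε₁)^{2D} − 1))·Σ‖ω_x‖² ≤ Re⟨ω, A(U,V)_φ ω⟩` for all `ω`.
[cite: Balaban1985BackgroundPropagators, Thm 3.4 p.400, (3.48)–(3.53) pp.398–400; Dimock2013, App. D, proof of Lemma 30; King1986, (4.33)–(4.34) p.674] -/
theorem re_conjForm_cxFullOp_ge {φ : Tor (fine L M) → ℝ} {δ ϑ : ℝ} (hφ : ∀ x μ, |φ x - φ (x + unitVec (fine L M) μ)| ≤ δ) (hϑ : ∀ x x', blockOf L M x = blockOf L M x' → |φ x - φ x'| ≤ ϑ)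
    (ω : Tor (fine L M) × n → 𝕜) :
    (κ / 2 - (2 * ((d : ℝ) + 1) * c * (Real.cosh δ - 1) + a * (Real.cosh ϑ - 1))
        - c * ((d : ℝ) + 1) * ((Real.exp δ * ε₂ + 2 * (Real.exp δ - 1) * ε₁) + 2 * (Real.exp δ * ε₁) ^ 2)
        - Real.exp ϑ * (a * ((1 + ε₁) ^ (2 * D) - 1))) * ∑ x, ‖fib (fine L M) ω x‖ ^ 2
      ≤ RCLike.re (star ω ⬝ᵥ (wtConj (fine L M) φ (cxFullOp T M a c m2 U V) *ᵥ ω)) := by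
  set N : ℝ := ∑ x, ‖fib (fine L M) ω x‖ ^ 2 with hN
  set E : ℝ := ∑ x, ∑ μ, bondE (fine L M) U₀ ω x μ with hE
  -- split `A(U,V) = A₀(U₀) + (A(U,V) − A₀(U₀))`
  have hsplit : wtConj (fine L M) φ (cxFullOp T M a c m2 U V)
      = wtConj (fine L M) φ (fullOpU T M a c m2 U₀) + wtConj (fine L M) φ (cxFullOp T M a c m2 U V - cxFullOp T M a c m2 U₀ (fun bd => (U₀ bd)ᴴ)) := by
    rw [← cxFullOp_adjoint T M a c m2 U₀, ← wtConj_add, add_sub_cancel]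
  rw [hsplit, Matrix.add_mulVec, dotProduct_add, map_add, wtConj_cxFullOp_sub_base, Matrix.add_mulVec, dotProduct_add, map_add, Matrix.neg_mulVec, dotProduct_neg, map_neg]
  -- (i) the base operator: Ϧ-b defect + coercivity + Dirichlet part
  have h1 := re_conjForm_fullOpU_sub_ge T M ha hc m2 hU₀ hφ hϑ ω
  have h2 := hcoer ω
  have h3 := re_quadForm_fullOpU_ge_dirichlet T M ha hm hU₀ ω (a := a) (c := c) (m2 := m2)
  -- (ii) the tilted hopping perturbation, `H¹`-bounded with half a gradient absorbed (θ = 1)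
  have hU' : ∀ bd, ‖tiltFwd (fine L M) φ (U - U₀) bd‖ ≤ Real.exp δ * ε₁ := fun bd =>
    (norm_tiltFwd_le (fine L M) hφ (U - U₀) bd).trans (mul_le_mul_of_nonneg_left (hU bd) (Real.exp_nonneg _))
  have hV' : ∀ bd, ‖tiltBwd (fine L M) φ (V - fun bd => (U₀ bd)ᴴ) bd‖ ≤ Real.exp δ * ε₁ := fun bd =>
    (norm_tiltBwd_le (fine L M) hφ (V - fun bd => (U₀ bd)ᴴ) bd).trans (mul_le_mul_of_nonneg_left (hV bd) (Real.exp_nonneg _))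
  have h0' : ∀ bd, ‖tiltFwd (fine L M) φ (U - U₀) bd * (U₀ bd)ᴴ + U₀ bd * tiltBwd (fine L M) φ (V - fun bd => (U₀ bd)ᴴ) bd‖ ≤ Real.exp δ * ε₂ + 2 * (Real.exp δ - 1) * ε₁ := by
    intro bd
    refine (norm_tilt_zeroth_le (fine L M) hφ hU₀ (U - U₀) (V - fun bd => (U₀ bd)ᴴ) bd).trans ?_
    have e1 := h0 bd
    have e2 := hV bd
    have hδ : 0 ≤ Real.exp δ - 1 := by
      have : |φ 0 - φ (0 + unitVec (fine L M) 0)| ≤ δ := hφ 0 0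
      have hδ0 : 0 ≤ δ := (abs_nonneg _).trans this
      linarith [Real.add_one_le_exp δ]
    simp only [Pi.sub_apply] at e1 e2 ⊢
    nlinarith [Real.exp_nonneg δ]
  have h4 := norm_quadForm_cxHop_le_absorbed (fine L M) hc hU₀ hU' hV' h0' one_pos ω
  have h4' : RCLike.re (star ω ⬝ᵥ (cxHop (fine L M) c (tiltFwd (fine L M) φ (U - U₀)) (tiltBwd (fine L M) φ (V - fun bd => (U₀ bd)ᴴ)) *ᵥ ω))
      ≤ c * ((d : ℝ) + 1) * ((Real.exp δ * ε₂ + 2 * (Real.exp δ - 1) * ε₁) + 2 * (Real.exp δ * ε₁) ^ 2 / 1) * N + 1 / 2 * (c * E) :=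
    (RCLike.re_le_norm _).trans h4
  -- (iii) the block term
  have h5 := re_star_dotProduct_mulVec_ge_neg_opNorm M
    (wtConj (fine L M) φ ((((a * (L : ℝ) ^ (d + 1) : ℝ)) : 𝕜) • (cxQadj T M V * covQ T M U - cxQadj T M (fun bd => (U₀ bd)ᴴ) * covQ T M U₀))) ω
  have h6 := l2_opNorm_wtConj_cxBlockTerm_sub_le T M hD ha hU₀ hε₁ hU hV hϑ
  have h7 : -(Real.exp ϑ * (a * ((1 + ε₁) ^ (2 * D) - 1)) * N)
      ≤ RCLike.re (star ω ⬝ᵥ (wtConj (fine L M) φ ((((a * (L : ℝ) ^ (d + 1) : ℝ)) : 𝕜) • (cxQadj T M V * covQ T M U - cxQadj T M (fun bd => (U₀ bd)ᴴ) * covQ T M U₀)) *ᵥ ω)) := by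
    have hN0 : 0 ≤ N := Finset.sum_nonneg fun _ _ => sq_nonneg _
    nlinarith
  rw [div_one] at h4'
  nlinarith [h1, h2, h3, h4', h7]

/-- ★★★ **THE UNWEIGHTED CASE**: `(κ∕2 − c(d+1)(ε₂ + 2ε₁²) − a((1+ε₁)^{2D} − 1))·Σ‖ω_x‖² ≤ Re⟨ω, A(U,V)ω⟩`. [cite: Balaban1985BackgroundPropagators, Thm 3.4 p.400, (3.48)–(3.53) pp.398–400] -/
theorem re_quadForm_cxFullOp_ge (ω : Tor (fine L M) × n → 𝕜) :
    (κ / 2 - c * ((d : ℝ) + 1) * (ε₂ + 2 * ε₁ ^ 2) - a * ((1 + ε₁) ^ (2 * D) - 1)) * ∑ x, ‖fib (fine L M) ω x‖ ^ 2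
      ≤ RCLike.re (star ω ⬝ᵥ (cxFullOp T M a c m2 U V *ᵥ ω)) := by
  have h := re_conjForm_cxFullOp_ge T M hD ha hc hm hU₀ hcoer hε₁ hU hV h0 (φ := fun _ => (0 : ℝ)) (δ := 0) (ϑ := 0) (fun _ _ => by simp) (fun _ _ _ => by simp) ω
  simp only [Real.cosh_zero, Real.exp_zero, sub_self, mul_zero, zero_mul, add_zero, one_mul, sub_zero] at h
  rwa [wtConj_const_zero'] at h

end Master

/-! ## §3 Consequences: invertibility, the norm of `G(U,V)`, exponential decay -/

section Consequences

variable {D : ℕ} (hD : ∀ j, T.depth j ≤ D)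
variable {a c m2 : ℝ} (ha : 0 ≤ a) (hc : 0 ≤ c) (hm : 0 ≤ m2)
variable {U₀ : Tor (fine L M) × Fin (d + 1) → Matrix n n 𝕜} (hU₀ : ∀ bd, U₀ bd ∈ Matrix.unitaryGroup n 𝕜)
variable {κ : ℝ} (hcoer : ∀ v : Tor (fine L M) × n → 𝕜, κ * ∑ x, ‖fib (fine L M) v x‖ ^ 2 ≤ RCLike.re (star v ⬝ᵥ (fullOpU T M a c m2 U₀ *ᵥ v)))
variable {U V : Tor (fine L M) × Fin (d + 1) → Matrix n n 𝕜} {ε₁ ε₂ : ℝ} (hε₁ : 0 ≤ ε₁)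
  (hU : ∀ bd, ‖U bd - U₀ bd‖ ≤ ε₁) (hV : ∀ bd, ‖V bd - (U₀ bd)ᴴ‖ ≤ ε₁) (h0 : ∀ bd, ‖(U bd - U₀ bd) * (U₀ bd)ᴴ + U₀ bd * (V bd - (U₀ bd)ᴴ)‖ ≤ ε₂)
include hD ha hc hm hU₀ hcoer hε₁ hU hV h0

/-- ★★★ **INVERTIBILITY IN THE COMPLEX WINDOW**: if the unweighted budget leaves `γ > 0`, `A(U,V)` is invertible. [cite: Balaban1985BackgroundPropagators, Thm 3.4 p.400] -/
theorem isUnit_cxFullOp_of_near {γ : ℝ} (hγ : 0 < γ) (hbud : γ ≤ κ / 2 - c * ((d : ℝ) + 1) * (ε₂ + 2 * ε₁ ^ 2) - a * ((1 + ε₁) ^ (2 * D) - 1)) :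
    IsUnit (cxFullOp T M a c m2 U V) :=
  isUnit_of_reCoercive (fine L M) hγ fun ω =>
    (mul_le_mul_of_nonneg_right hbud (Finset.sum_nonneg fun _ _ => sq_nonneg _)).trans (re_quadForm_cxFullOp_ge T M hD ha hc hm hU₀ hcoer hε₁ hU hV h0 ω)

/-- ★★★ **THE NORM OF THE PROPAGATOR IN THE COMPLEX WINDOW**: `‖G(U,V)‖ ≤ γ⁻¹`. [cite: Balaban1985BackgroundPropagators, Thm 3.4 p.400, (3.46) p.398 (shape)] -/
theorem l2_opNorm_cxFullOp_inv_le_of_near {γ : ℝ} (hγ : 0 < γ) (hbud : γ ≤ κ / 2 - c * ((d : ℝ) + 1) * (ε₂ + 2 * ε₁ ^ 2) - a * ((1 + ε₁) ^ (2 * D) - 1)) :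
    ‖(cxFullOp T M a c m2 U V)⁻¹‖ ≤ γ⁻¹ :=
  l2_opNorm_inv_le_of_reCoercive (fine L M) hγ fun ω =>
    (mul_le_mul_of_nonneg_right hbud (Finset.sum_nonneg fun _ _ => sq_nonneg _)).trans (re_quadForm_cxFullOp_ge T M hD ha hc hm hU₀ hcoer hε₁ hU hV h0 ω)

/-- ★★★★ **EXPONENTIAL DECAY IN THE COMPLEX WINDOW**: with the tree weight of rate `κ_w ≥ 0`, if the WEIGHTED budget leaves `γ > 0`
(`γ ≤ κ∕2 − (2(d+1)c(cosh(κ_w∕L)−1) + a(cosh κ_w − 1)) − c(d+1)((e^{κ_w∕L}ε₂ + 2(e^{κ_w∕L}−1)ε₁) + 2(e^{κ_w∕L}ε₁)²) − e^{κ_w}a((1+ε₁)^{2D} − 1)`), then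
`‖blk G(U,V) x y‖ ≤ γ⁻¹·e^{−(κ_w∕L)d(x,y)}` for all sites. [cite: Balaban1985BackgroundPropagators, Thm 3.4 p.400 («the extended operators satisfy all the inequalities of Theorems 3.1–3.3»), (3.39) p.397; King1986, (4.33) p.674] -/
theorem norm_blk_cxFullOp_inv_le_of_near {κw γ : ℝ} (hκw : 0 ≤ κw) (hγ : 0 < γ)
    (hbud : γ ≤ κ / 2 - (2 * ((d : ℝ) + 1) * c * (Real.cosh (κw / L) - 1) + a * (Real.cosh κw - 1))
        - c * ((d : ℝ) + 1) * ((Real.exp (κw / L) * ε₂ + 2 * (Real.exp (κw / L) - 1) * ε₁) + 2 * (Real.exp (κw / L) * ε₁) ^ 2)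
        - Real.exp κw * (a * ((1 + ε₁) ^ (2 * D) - 1))) (x y : Tor (fine L M)) :
    ‖blk (cxFullOp T M a c m2 U V)⁻¹ x y‖ ≤ γ⁻¹ * Real.exp (-(κw / L * tdistT (fine L M) x y)) := by
  have h := norm_blk_inv_le_of_conjCoercive (fine L M) (T := cxFullOp T M a c m2 U V) (φ := ctW L M κw y) hγ (fun ω =>
    (mul_le_mul_of_nonneg_right hbud (Finset.sum_nonneg fun _ _ => sq_nonneg _)).trans
      (re_conjForm_cxFullOp_ge T M hD ha hc hm hU₀ hcoer hε₁ hU hV h0 (fun x μ => (abs_ctW_bond_le L M hκw y x μ).1) (fun x x' h => abs_ctW_block_le L M hκw y x x' h) ω)) x y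
  rwa [ctW_sub_ctW_centre] at h

/-- ★★★ DIMOCK's BILINEAR CURRENCY IN THE WINDOW: `|⟨f, G(U,V)g⟩| ≤ γ⁻¹‖e^{−ctW}f‖‖e^{ctW}g‖` for every centre `x₀`. [cite: Dimock2013, App. D, Lemma 30; Balaban1985BackgroundPropagators, Thm 3.4 p.400] -/
theorem norm_star_dotProduct_cxFullOp_inv_mulVec_le_of_near {κw γ : ℝ} (hκw : 0 ≤ κw) (hγ : 0 < γ)
    (hbud : γ ≤ κ / 2 - (2 * ((d : ℝ) + 1) * c * (Real.cosh (κw / L) - 1) + a * (Real.cosh κw - 1))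
        - c * ((d : ℝ) + 1) * ((Real.exp (κw / L) * ε₂ + 2 * (Real.exp (κw / L) - 1) * ε₁) + 2 * (Real.exp (κw / L) * ε₁) ^ 2)
        - Real.exp κw * (a * ((1 + ε₁) ^ (2 * D) - 1))) (x₀ : Tor (fine L M)) (f g : Tor (fine L M) × n → 𝕜) :
    ‖star f ⬝ᵥ ((cxFullOp T M a c m2 U V)⁻¹ *ᵥ g)‖
      ≤ γ⁻¹ * ‖(toLp 2 (expWt (fine L M) (fun x => -ctW L M κw x₀ x) f) : EuclideanSpace 𝕜 (Tor (fine L M) × n))‖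
        * ‖(toLp 2 (expWt (fine L M) (ctW L M κw x₀) g) : EuclideanSpace 𝕜 (Tor (fine L M) × n))‖ :=
  norm_star_dotProduct_inv_mulVec_le (fine L M) (T := cxFullOp T M a c m2 U V) (φ := ctW L M κw x₀) hγ (fun ω =>
    (mul_le_mul_of_nonneg_right hbud (Finset.sum_nonneg fun _ _ => sq_nonneg _)).trans
      (re_conjForm_cxFullOp_ge T M hD ha hc hm hU₀ hcoer hε₁ hU hV h0 (fun x μ => (abs_ctW_bond_le L M hκw x₀ x μ).1) (fun x x' h => abs_ctW_block_le L M hκw x₀ x x' h) ω)) f g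

end Consequences

/-! ## §4 King's scaling `c = L²`: the window on Bałaban's variables `s = Lε₁`, `t = L²ε₂` -/

section King

omit [NeZero L] in
/-- THE TILT BOOKKEEPING IN KING's SCALING: for `L ≥ 1`, `0 ≤ κ_w ≤ 1`, `ε₁, ε₂ ≥ 0`, `s = Lε₁`, `t = L²ε₂`:
`L²·((e^{κ_w∕L}ε₂ + 2(e^{κ_w∕L} − 1)ε₁) + 2(e^{κ_w∕L}ε₁)²) ≤ e(t + 2s) + 2e²s²` (`e^{κ_w∕L} ≤ e`, `L(e^{κ_w∕L} − 1) ≤ e·κ_w ≤ e`). [folklore] -/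
theorem king_tilt_bookkeeping (hL : 1 ≤ L) {κw ε₁ ε₂ : ℝ} (hκw0 : 0 ≤ κw) (hκw1 : κw ≤ 1) (hε₁ : 0 ≤ ε₁) (hε₂ : 0 ≤ ε₂) :
    (L : ℝ) ^ 2 * ((Real.exp (κw / L) * ε₂ + 2 * (Real.exp (κw / L) - 1) * ε₁) + 2 * (Real.exp (κw / L) * ε₁) ^ 2)
      ≤ Real.exp 1 * ((L : ℝ) ^ 2 * ε₂ + 2 * ((L : ℝ) * ε₁)) + 2 * Real.exp 1 ^ 2 * ((L : ℝ) * ε₁) ^ 2 := by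
  have hL0 : (1 : ℝ) ≤ L := by exact_mod_cast hL
  have hx1 : κw / L ≤ 1 := (div_le_one (by linarith)).2 (hκw1.trans hL0)
  have hx0 : 0 ≤ κw / L := div_nonneg hκw0 (by linarith)
  have he : Real.exp (κw / L) ≤ Real.exp 1 := Real.exp_le_exp.2 hx1
  -- `L(e^{x} − 1) ≤ L·x·e^{x} ≤ κ_w·e ≤ e`
  have hem1 : (L : ℝ) * (Real.exp (κw / L) - 1) ≤ Real.exp 1 := by
    have h1 : Real.exp (κw / L) - 1 ≤ κw / L * Real.exp (κw / L) := by
      have := Real.add_one_le_exp (-(κw / L))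
      have hprod : Real.exp (κw / L) * Real.exp (-(κw / L)) = 1 := by rw [← Real.exp_add, add_neg_cancel, Real.exp_zero]
      nlinarith [Real.exp_pos (κw / L), Real.exp_pos (-(κw / L))]
    calc (L : ℝ) * (Real.exp (κw / L) - 1) ≤ (L : ℝ) * (κw / L * Real.exp (κw / L)) := mul_le_mul_of_nonneg_left h1 (by linarith)
      _ = κw * Real.exp (κw / L) := by field_simp
      _ ≤ 1 * Real.exp 1 := mul_le_mul hκw1 he (Real.exp_nonneg _) zero_le_one
      _ = Real.exp 1 := one_mul _
  have hpos : 0 ≤ Real.exp (κw / L) := Real.exp_nonneg _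
  have t1 : (L : ℝ) ^ 2 * (Real.exp (κw / L) * ε₂) ≤ Real.exp 1 * ((L : ℝ) ^ 2 * ε₂) := by
    calc (L : ℝ) ^ 2 * (Real.exp (κw / L) * ε₂) = Real.exp (κw / L) * ((L : ℝ) ^ 2 * ε₂) := by ring
      _ ≤ Real.exp 1 * ((L : ℝ) ^ 2 * ε₂) := mul_le_mul_of_nonneg_right he (by positivity)
  have t2 : (L : ℝ) ^ 2 * (2 * (Real.exp (κw / L) - 1) * ε₁) ≤ Real.exp 1 * (2 * ((L : ℝ) * ε₁)) := by
    calc (L : ℝ) ^ 2 * (2 * (Real.exp (κw / L) - 1) * ε₁) = ((L : ℝ) * (Real.exp (κw / L) - 1)) * (2 * ((L : ℝ) * ε₁)) := by ring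
      _ ≤ Real.exp 1 * (2 * ((L : ℝ) * ε₁)) := mul_le_mul_of_nonneg_right hem1 (by positivity)
  have t3 : (L : ℝ) ^ 2 * (2 * (Real.exp (κw / L) * ε₁) ^ 2) ≤ 2 * Real.exp 1 ^ 2 * ((L : ℝ) * ε₁) ^ 2 := by
    have : (L : ℝ) ^ 2 * (2 * (Real.exp (κw / L) * ε₁) ^ 2) = 2 * Real.exp (κw / L) ^ 2 * ((L : ℝ) * ε₁) ^ 2 := by ring
    rw [this]
    have : Real.exp (κw / L) ^ 2 ≤ Real.exp 1 ^ 2 := pow_le_pow_left₀ hpos he 2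
    nlinarith [sq_nonneg ((L : ℝ) * ε₁)]
  nlinarith

variable {D : ℕ} (hD : ∀ j, T.depth j ≤ D)
variable {a m2 : ℝ} (ha : 0 ≤ a) (hm : 0 ≤ m2) (hL : 1 ≤ L)
variable {U₀ : Tor (fine L M) × Fin (d + 1) → Matrix n n 𝕜} (hU₀ : ∀ bd, U₀ bd ∈ Matrix.unitaryGroup n 𝕜)
variable {κ : ℝ} (hκ : 0 < κ) (hcoer : ∀ v : Tor (fine L M) × n → 𝕜, κ * ∑ x, ‖fib (fine L M) v x‖ ^ 2 ≤ RCLike.re (star v ⬝ᵥ (fullOpU T M a ((L : ℝ) ^ 2) m2 U₀ *ᵥ v)))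
variable {U V : Tor (fine L M) × Fin (d + 1) → Matrix n n 𝕜} {ε₁ ε₂ : ℝ} (hε₁ : 0 ≤ ε₁)
  (hU : ∀ bd, ‖U bd - U₀ bd‖ ≤ ε₁) (hV : ∀ bd, ‖V bd - (U₀ bd)ᴴ‖ ≤ ε₁) (h0 : ∀ bd, ‖(U bd - U₀ bd) * (U₀ bd)ᴴ + U₀ bd * (V bd - (U₀ bd)ᴴ)‖ ≤ ε₂)
include hD ha hm hL hU₀ hκ hcoer hε₁ hU hV h0

/-- ★★★ **INVERTIBILITY IN KING's SCALING** under the unweighted budget `(d+1)(L²ε₂ + 2(Lε₁)²) + a((1+ε₁)^{2D} − 1) ≤ κ∕4`. [cite: Balaban1985BackgroundPropagators, Thm 3.4 p.400] -/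
theorem isUnit_cxFullOp_king_of_near (hwin : ((d : ℝ) + 1) * ((L : ℝ) ^ 2 * ε₂ + 2 * ((L : ℝ) * ε₁) ^ 2) + a * ((1 + ε₁) ^ (2 * D) - 1) ≤ κ / 4) :
    IsUnit (cxFullOp T M a ((L : ℝ) ^ 2) m2 U V) := by
  refine isUnit_cxFullOp_of_near T M hD ha (by positivity) hm hU₀ hcoer hε₁ hU hV h0 (γ := κ / 4) (by positivity) ?_
  have : (L : ℝ) ^ 2 * (((d : ℝ) + 1) * (ε₂ + 2 * ε₁ ^ 2)) = ((d : ℝ) + 1) * ((L : ℝ) ^ 2 * ε₂ + 2 * ((L : ℝ) * ε₁) ^ 2) := by ring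
  nlinarith

/-- ★★★ **THE NORM OF `G(U,V)` IN KING's SCALING**: the same budget ⟹ `‖G(U,V)‖ ≤ 4∕κ`. [cite: Balaban1985BackgroundPropagators, Thm 3.4 p.400, (3.46) p.398 (shape)] -/
theorem l2_opNorm_cxFullOp_inv_le_king_of_near (hwin : ((d : ℝ) + 1) * ((L : ℝ) ^ 2 * ε₂ + 2 * ((L : ℝ) * ε₁) ^ 2) + a * ((1 + ε₁) ^ (2 * D) - 1) ≤ κ / 4) :
    ‖(cxFullOp T M a ((L : ℝ) ^ 2) m2 U V)⁻¹‖ ≤ 4 / κ := by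
  rw [show (4 : ℝ) / κ = (κ / 4)⁻¹ by rw [inv_div]]
  refine l2_opNorm_cxFullOp_inv_le_of_near T M hD ha (by positivity) hm hU₀ hcoer hε₁ hU hV h0 (γ := κ / 4) (by positivity) ?_
  have : (L : ℝ) ^ 2 * (((d : ℝ) + 1) * (ε₂ + 2 * ε₁ ^ 2)) = ((d : ℝ) + 1) * ((L : ℝ) ^ 2 * ε₂ + 2 * ((L : ℝ) * ε₁) ^ 2) := by ring
  nlinarith

/-- ★★★★ **EXPONENTIAL DECAY IN KING's SCALING, IN THE COMPLEX WINDOW**: rate `κ_w = ctRate(κ∕2, a, d)` (Ϧ-c; `ρ ≤ κ∕4`), and the WEIGHTED budget on Bałaban's variables `s = Lε₁`, `t = L²ε₂`: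
`(d+1)(e(t + 2s) + 2e²s²) + e·a·((1+ε₁)^{2D} − 1) ≤ κ∕8` ⟹ `‖blk G(U,V) x y‖ ≤ (8∕κ)·e^{−ctRate(κ∕2,a,d)·d(x,y)∕L}` — every volume, every fibre, every such `(U,V)`.
[cite: Balaban1985BackgroundPropagators, Thm 3.4 p.400, (3.39) p.397; King1986, (4.33) p.674; Dimock2013, App. D, Lemma 30] -/
theorem norm_blk_cxFullOp_inv_le_king_of_near (hε₂ : 0 ≤ ε₂)
    (hwin : ((d : ℝ) + 1) * (Real.exp 1 * ((L : ℝ) ^ 2 * ε₂ + 2 * ((L : ℝ) * ε₁)) + 2 * Real.exp 1 ^ 2 * ((L : ℝ) * ε₁) ^ 2) + Real.exp 1 * (a * ((1 + ε₁) ^ (2 * D) - 1)) ≤ κ / 8)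
    (x y : Tor (fine L M)) :
    ‖blk (cxFullOp T M a ((L : ℝ) ^ 2) m2 U V)⁻¹ x y‖ ≤ 8 / κ * Real.exp (-(ctRate (κ / 2) a d / L * tdistT (fine L M) x y)) := by
  have hκ2 : 0 < κ / 2 := by positivity
  set κw := ctRate (κ / 2) a d with hκwdef
  have hκw0 : 0 ≤ κw := ctRate_nonneg _ _ _
  have hκw1 : κw ≤ 1 := ctRate_le_one _ _ _
  have hρ := half_le_sub_rho_ctRate (d := d) hL hκ2 ha
  have hbook := king_tilt_bookkeeping hL hκw0 hκw1 hε₁ hε₂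
  have heκ : Real.exp κw ≤ Real.exp 1 := Real.exp_le_exp.2 hκw1
  have hτ : 0 ≤ a * ((1 + ε₁) ^ (2 * D) - 1) := mul_nonneg ha (sub_nonneg.2 (one_le_pow₀ (by linarith)))
  rw [show (8 : ℝ) / κ = (κ / 8)⁻¹ by rw [inv_div]]
  refine norm_blk_cxFullOp_inv_le_of_near T M hD ha (by positivity) hm hU₀ hcoer hε₁ hU hV h0 hκw0 (γ := κ / 8) (by positivity) ?_ x y
  have hc2 : (L : ℝ) ^ 2 * (((d : ℝ) + 1) * ((Real.exp (κw / L) * ε₂ + 2 * (Real.exp (κw / L) - 1) * ε₁) + 2 * (Real.exp (κw / L) * ε₁) ^ 2))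
      ≤ ((d : ℝ) + 1) * (Real.exp 1 * ((L : ℝ) ^ 2 * ε₂ + 2 * ((L : ℝ) * ε₁)) + 2 * Real.exp 1 ^ 2 * ((L : ℝ) * ε₁) ^ 2) := by
    have : (L : ℝ) ^ 2 * (((d : ℝ) + 1) * ((Real.exp (κw / L) * ε₂ + 2 * (Real.exp (κw / L) - 1) * ε₁) + 2 * (Real.exp (κw / L) * ε₁) ^ 2))
        = ((d : ℝ) + 1) * ((L : ℝ) ^ 2 * ((Real.exp (κw / L) * ε₂ + 2 * (Real.exp (κw / L) - 1) * ε₁) + 2 * (Real.exp (κw / L) * ε₁) ^ 2)) := by ring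
    rw [this]
    exact mul_le_mul_of_nonneg_left hbook (by positivity)
  have hblock : Real.exp κw * (a * ((1 + ε₁) ^ (2 * D) - 1)) ≤ Real.exp 1 * (a * ((1 + ε₁) ^ (2 * D) - 1)) := mul_le_mul_of_nonneg_right heκ hτ
  nlinarith

end King

end Summit.QuantumFields.YangMills.BalabanUVNodes.N15KingModelRung.Analytic

end
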